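import Literature.MathematicalPhysics.QuantumLattice.GrassmannPairLaplacians
import Literature.MathematicalPhysics.QuantumLattice.FermionicTreeExpansion
import Literature.Probability.LatticeModels.BattleFederbushExponential
import HarnessLib

/-!
# The Brydges–Battle–Federbush tree expansion of the Gaussian convolution `e^{Δ_C}`
# (operator form; truncated expectations of even cluster elements, BGM 2006 (2.66))

Topic `Literature/MathematicalPhysics/QuantumLattice`; the tree formula for the truncated
expectations of the fermionic Gaussian convolution `μ_C ⋆ = e^{Δ_C}` of `GrassmannLaplacian.lean`
(Salmhofer 1999, Prop. 4.3) in the form needed by the single-scale step of the renormalisation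
group (Benfatto–Giuliani–Mastropietro 2006, §2.3, (2.66); Mastropietro 2008, §2.8–2.9,
(2.83)–(2.118)), proved at the level of OPERATORS: neither inverses of the covariance, nor
determinants, nor the orientation sign of (2.66), nor the splitting of the vertices into internal
and external fields appear — the fields that are not contracted simply stay in the algebra, and the
values are elements of the commutative even part `⋀^{even}`.

## The expansion

Fix a cluster map `cl : Γ → ι` of the field labels and a covariance `C`.  The pair Laplacians
`Δ_{C|ℓ}`, `ℓ ∈ Sym2 ι` (`GrassmannPairLaplacians.lean`) commute and are nilpotent; they generate
commutative subalgebras `lapAdjoin R C cl I` of `End(⋀Γ)` (`laplacianAlgebra` for all of them), in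
which `exp (Σ_ℓ Δ_{C|ℓ}) = e^{Δ_C}` (`coe_exp_sum_pairLap`).  The abstract Battle–Brydges–Federbush
expansion of an exponential of commuting nilpotents (`BattleFederbushExponential.lean`) is therefore
the **operator identity** (`gaussConv_apply_eq_sum`)

`e^{Δ_C} = Σ_{valid scripts s} treeFactor s ∘ exp (Σ_{ℓ outside Q_s} Δ_{C|ℓ})`,
`treeFactor s = ∫_{[0,1]^ι} w_s(t) (∏_{ℓ ∈ lines s} Δ_{C|ℓ}) e^{Δ_{σ_s(t) ∘ C | Q_s}} dt`.

## Support calculus and the tree formula for truncated expectations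

For EVEN elements `M v` supported on the fields of cluster `v` the three facts
`expOut_apply_mul_left` (the outer exponential passes a factor supported in `Q`),
`expOut_apply_of_mem` (on elements supported outside `Q` it acts as `e^{Δ_C}`) and
`treeFactor_apply_mul_right` (the tree factor, which lies in the algebra of the `Δ_{C|ℓ}`, `ℓ ⊆ Q_s`
— `coe_treeFactor_mem_lapAdjoin` — passes factors supported outside `Q_s`), together with
`prod_pairLap_apply_eq_zero` (a line leaving `W` kills the fields of `W`), give the peeling recursion
for the **convolution moments** `Q ↦ e^{Δ_C}(∏_{v∈Q} M v) ∈ ⋀^{even}` (`convMoment_eq_sum_treeOp`) and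
hence, by uniqueness of the block recursion, the **tree formula for the truncated expectations**
(**`ursellOf_convMoment_eq_treeOp`**):

`𝓔ᵀ_C(M v : v ∈ W) = treeOp v W (∏_{v∈W} M v)`,
`treeOp v W = Σ_{valid s rooted at v with point set W} treeFactor s`,

Benfatto–Giuliani–Mastropietro's (2.66) with the lower-scale fields kept as spectators in the
algebra.  Everything is proved; no named fact.

## Sources

G. Benfatto, A. Giuliani, V. Mastropietro, Ann. Henri Poincaré 7 (2006) 809–898, §2.3 (2.66)–(2.67)
(bib key `BenfattoGiulianiMastropietro2006`); V. Mastropietro, *Non-Perturbative Renormalization*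
(2008), §2.8–2.9 (2.83)–(2.118) (`Mastropietro2008`); M. Salmhofer, *Renormalization* (1999), §4.3
Prop. 4.3, §2.5 (`Salmhofer1999`); D. C. Brydges, Les Houches 1984 (`Brydges1986`).
-/

noncomputable section

open MvPolynomial Finset Literature.RingTheory.MvPolynomial
open Literature.Probability.LatticeModels Literature.Probability.LatticeModels.BattleFederbush

namespace Literature.MathematicalPhysics.QuantumLattice

open GrassmannAlgebra

/-! ### The commutative algebras generated by pair Laplacians -/

section LaplacianAlgebra

variable (R : Type*) [CommRing R] [Algebra ℚ R] {Γ : Type*} [Fintype Γ]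
variable {ι : Type*} [DecidableEq ι] (C : Matrix Γ Γ R) (cl : Γ → ι)

/-- The subalgebra of `End(⋀Γ)` generated by the pair Laplacians `Δ_{C|ℓ}`, `ℓ ∈ I`. [folklore] -/
def lapAdjoin (I : Set (Sym2 ι)) : Subalgebra R (Module.End R (GrassmannAlgebra R Γ)) :=
  Algebra.adjoin R (pairLaplacian R C cl '' I)

/-- The **algebra of the pair Laplacians**: the subalgebra of `End(⋀Γ)` generated by all the
`Δ_{C|ℓ}`, `ℓ ∈ Sym2 ι`. [folklore] -/
abbrev laplacianAlgebra : Subalgebra R (Module.End R (GrassmannAlgebra R Γ)) := lapAdjoin R C cl Set.univ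

/-- The algebras generated by pair Laplacians are commutative. [folklore] -/
instance isMulCommutative_lapAdjoin (I : Set (Sym2 ι)) : IsMulCommutative (lapAdjoin R C cl I) :=
  Algebra.isMulCommutative_adjoin R fun a ha b hb => by
    obtain ⟨ℓ, -, rfl⟩ := ha
    obtain ⟨ℓ', -, rfl⟩ := hb
    exact (commute_pairLaplacian R C cl ℓ ℓ').eq

/-- … hence commutative rings. [folklore] -/
instance instCommRingLapAdjoin (I : Set (Sym2 ι)) : CommRing (lapAdjoin R C cl I) :=
  { (inferInstance : Ring (lapAdjoin R C cl I)) with mul_comm := mul_comm' }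

/-- Monotonicity in the set of pair types. [folklore] -/
theorem lapAdjoin_mono {I J : Set (Sym2 ι)} (h : I ⊆ J) : lapAdjoin R C cl I ≤ lapAdjoin R C cl J :=
  Algebra.adjoin_mono (Set.image_mono h)

/-- `Δ_{C|ℓ} ∈ lapAdjoin I` for `ℓ ∈ I`. [folklore] -/
theorem pairLaplacian_mem_lapAdjoin {I : Set (Sym2 ι)} {ℓ : Sym2 ι} (h : ℓ ∈ I) :
    pairLaplacian R C cl ℓ ∈ lapAdjoin R C cl I :=
  Algebra.subset_adjoin ⟨ℓ, h, rfl⟩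

/-- The pair Laplacian `Δ_{C|ℓ}` as an element of the algebra of the pair Laplacians. [folklore] -/
def pairLap (ℓ : Sym2 ι) : laplacianAlgebra R C cl :=
  ⟨pairLaplacian R C cl ℓ, pairLaplacian_mem_lapAdjoin R C cl (Set.mem_univ ℓ)⟩

/-- Unfolding `pairLap`. [folklore] -/
@[simp] theorem coe_pairLap (ℓ : Sym2 ι) :
    (pairLap R C cl ℓ : Module.End R (GrassmannAlgebra R Γ)) = pairLaplacian R C cl ℓ := rfl

/-- Nilpotency descends to the subalgebras. [folklore] -/
theorem isNilpotent_of_coe {I : Set (Sym2 ι)} {a : lapAdjoin R C cl I}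
    (ha : IsNilpotent (a : Module.End R (GrassmannAlgebra R Γ))) : IsNilpotent a :=
  (IsNilpotent.map_iff (f := (lapAdjoin R C cl I).val) Subtype.val_injective).1 ha

/-- The pair Laplacians are nilpotent elements of their algebra. [folklore] -/
theorem isNilpotent_pairLap (ℓ : Sym2 ι) : IsNilpotent (pairLap R C cl ℓ) :=
  isNilpotent_of_coe R C cl (isNilpotent_pairLaplacian R C cl ℓ)

/-- Elements of the algebras of pair Laplacians preserve parity. [folklore] -/
theorem apply_mem_evenOdd_of_mem_lapAdjoin {I : Set (Sym2 ι)} {T : Module.End R (GrassmannAlgebra R Γ)}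
    (hT : T ∈ lapAdjoin R C cl I) {i : ZMod 2} {a : GrassmannAlgebra R Γ} (ha : a ∈ evenOdd R i) :
    T a ∈ evenOdd R i := by
  induction hT using Algebra.adjoin_induction generalizing a with
  | mem x hx => obtain ⟨ℓ, -, rfl⟩ := hx; exact grassmannLaplacian_mem_evenOdd R _ ha
  | algebraMap r => rw [Module.algebraMap_end_apply]; exact Submodule.smul_mem _ _ ha
  | add x y _ _ hx hy => rw [LinearMap.add_apply]; exact add_mem (hx ha) (hy ha)
  | mul x y _ _ hx hy => rw [Module.End.mul_apply]; exact hx (hy ha)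

/-- Elements of the algebras of pair Laplacians preserve the field-supported subalgebras.
[folklore] -/
theorem apply_mem_fieldSubalgebra_of_mem_lapAdjoin [DecidableEq Γ] {I : Set (Sym2 ι)}
    {T : Module.End R (GrassmannAlgebra R Γ)} (hT : T ∈ lapAdjoin R C cl I) {S : Set Γ}
    {a : GrassmannAlgebra R Γ} (ha : a ∈ fieldSubalgebra R S) : T a ∈ fieldSubalgebra R S := by
  induction hT using Algebra.adjoin_induction generalizing a with
  | mem x hx => obtain ⟨ℓ, -, rfl⟩ := hx; exact grassmannLaplacian_mem_fieldSubalgebra R _ ha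
  | algebraMap r => rw [Module.algebraMap_end_apply]; exact Subalgebra.smul_mem _ ha r
  | add x y _ _ hx hy => rw [LinearMap.add_apply]; exact add_mem (hx ha) (hy ha)
  | mul x y _ _ hx hy => rw [Module.End.mul_apply]; exact hx (hy ha)

/-- The exponential in the algebra of pair Laplacians is the exponential of endomorphisms.
[folklore] -/
theorem coe_exp {I : Set (Sym2 ι)} {a : lapAdjoin R C cl I} (ha : IsNilpotent a) :
    ((IsNilpotent.exp a : lapAdjoin R C cl I) : Module.End R (GrassmannAlgebra R Γ)) =
      IsNilpotent.exp (a : Module.End R (GrassmannAlgebra R Γ)) :=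
  ha.map_exp (lapAdjoin R C cl I).val

/-- A sum of pair Laplacians is nilpotent in the algebra. [folklore] -/
theorem isNilpotent_sum_pairLap (S : Finset (Sym2 ι)) : IsNilpotent (∑ ℓ ∈ S, pairLap R C cl ℓ) :=
  Commute.isNilpotent_sum (fun ℓ _ => isNilpotent_pairLap R C cl ℓ) fun _ _ _ _ => Commute.all _ _

/-- **`exp (Σ_ℓ Δ_{C|ℓ}) = e^{Δ_C}`** in the algebra of the pair Laplacians. [folklore] -/
theorem coe_exp_sum_pairLap [Fintype ι] :
    ((IsNilpotent.exp (∑ ℓ : Sym2 ι, pairLap R C cl ℓ) : laplacianAlgebra R C cl) :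
      Module.End R (GrassmannAlgebra R Γ)) = gaussConv R C := by
  rw [coe_exp R C cl (isNilpotent_sum_pairLap R C cl _), AddSubmonoidClass.coe_finsetSum]
  simp only [coe_pairLap]
  rw [sum_pairLaplacian, gaussConv_def]

/-- Evaluation of an element of the algebra of pair Laplacians at an element of `⋀Γ` (linear in the
operator). [folklore] -/
def applyOp (a : GrassmannAlgebra R Γ) : laplacianAlgebra R C cl →ₗ[R] GrassmannAlgebra R Γ :=
  (LinearMap.applyₗ a).comp (laplacianAlgebra R C cl).val.toLinearMap

/-- Unfolding `applyOp`. [folklore] -/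
@[simp] theorem applyOp_apply (a : GrassmannAlgebra R Γ) (T : laplacianAlgebra R C cl) :
    applyOp R C cl a T = (T : Module.End R (GrassmannAlgebra R Γ)) a := rfl

/-- **The operator form of the Battle–Brydges–Federbush expansion of `e^{Δ_C}`** (Mastropietro 2008,
§2.8 (2.91)–(2.99) for the Gaussian convolution; Benfatto–Giuliani–Mastropietro 2006, (2.66)): for
every root `v` and every `a ∈ ⋀Γ`,
`e^{Δ_C} a = Σ_{k<|ι|} Σ_{valid scripts s rooted at v} treeFactor s (exp (Σ_{ℓ outside Q_s} Δ_{C|ℓ}) a)`.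
[cite: Mastropietro2008, §2.8 (2.91)-(2.99)] -/
theorem gaussConv_apply_eq_sum [Fintype ι] (v : ι) (a : GrassmannAlgebra R Γ) :
    gaussConv R C a = ∑ k ∈ Finset.range (Fintype.card ι), ∑ s : Script v k,
      if s.Valid then ((Script.treeFactor (pairLap R C cl) s : laplacianAlgebra R C cl) : Module.End R (GrassmannAlgebra R Γ))
        (((expOut (pairLap R C cl) (univ.image s.y) : laplacianAlgebra R C cl) : Module.End R (GrassmannAlgebra R Γ)) a) else 0 := by
  have h := congrArg (applyOp R C cl a) (exp_sum_eq_sum_treeFactor_mul_expOut (isNilpotent_pairLap R C cl) v)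
  rw [applyOp_apply, coe_exp_sum_pairLap] at h
  rw [h, map_sum]
  refine Finset.sum_congr rfl fun k _ => ?_
  rw [map_sum]
  refine Finset.sum_congr rfl fun s _ => ?_
  split_ifs
  · rw [applyOp_apply, MulMemClass.coe_mul, Module.End.mul_apply]
  · exact map_zero _

end LaplacianAlgebra

/-! ### Support calculus: what the outer exponential and the tree factor pass -/

section ExpPass

variable (R : Type*) [CommRing R] [Algebra ℚ R] {Γ : Type*}

/-- A nilpotent exponential passes whatever its exponent passes (left factors). [folklore] -/
theorem exp_apply_mul_left {T : Module.End R (GrassmannAlgebra R Γ)} (hT : IsNilpotent T)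
    {a : GrassmannAlgebra R Γ} (h : ∀ b, T (a * b) = a * T b) (b : GrassmannAlgebra R Γ) :
    IsNilpotent.exp T (a * b) = a * IsNilpotent.exp T b := by
  have hp : ∀ n c, (T ^ n) (a * c) = a * (T ^ n) c := by
    intro n
    induction n with
    | zero => intro c; simp
    | succ n ih => intro c; rw [pow_succ, Module.End.mul_apply, h, ih, Module.End.mul_apply]
  obtain ⟨k, hk⟩ := hT
  rw [IsNilpotent.exp_eq_sum hk]
  simp only [LinearMap.coe_sum, Finset.sum_apply, LinearMap.smul_apply, hp, Finset.mul_sum, mul_smul_comm]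

end ExpPass

section Support

variable (R : Type*) [CommRing R] [Algebra ℚ R] {Γ : Type*} [Fintype Γ] [DecidableEq Γ]
variable {ι : Type*} [Fintype ι] [DecidableEq ι] (C : Matrix Γ Γ R) (cl : Γ → ι)

omit [Fintype ι] in
/-- **The outer exponential passes an even factor supported in `Q`**:
`exp (Σ_{ℓ outside Q} Δ_{C|ℓ}) (a b) = a · exp (Σ_{ℓ outside Q} Δ_{C|ℓ}) b` for `a` even in
`fieldSubalgebra (cl⁻¹ Q)`. [folklore] -/
theorem expOut_apply_mul_left [Fintype ι] (Q : Finset ι) {a : GrassmannAlgebra R Γ}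
    (ha : a ∈ fieldSubalgebra R (cl ⁻¹' (Q : Set ι))) (ha0 : a ∈ evenOdd R 0) (b : GrassmannAlgebra R Γ) :
    ((expOut (pairLap R C cl) Q : laplacianAlgebra R C cl) : Module.End R (GrassmannAlgebra R Γ)) (a * b) =
      a * ((expOut (pairLap R C cl) Q : laplacianAlgebra R C cl) : Module.End R (GrassmannAlgebra R Γ)) b := by
  have hnil : IsNilpotent ((outerSum (pairLap R C cl) Q : laplacianAlgebra R C cl) : Module.End R (GrassmannAlgebra R Γ)) :=
    (isNilpotent_outerSum (isNilpotent_pairLap R C cl) Q).map (laplacianAlgebra R C cl).val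
  rw [expOut, coe_exp R C cl (isNilpotent_outerSum (isNilpotent_pairLap R C cl) Q)]
  refine exp_apply_mul_left R hnil (fun b' => ?_) b
  rw [outerSum, AddSubmonoidClass.coe_finsetSum]
  simp only [coe_pairLap, LinearMap.coe_sum, Finset.sum_apply, Finset.mul_sum]
  refine Finset.sum_congr rfl fun ℓ hℓ => ?_
  exact pairLaplacian_mul_eq_mul_left R C cl (Q := (Q : Set ι))
    (fun w hw => by exact_mod_cast (outsideB_eq_true_iff Q ℓ).1 (Finset.mem_filter.1 hℓ).2 w hw) ha ha0 b'

omit [Fintype ι] in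
/-- **On elements supported outside `Q` the outer exponential acts as the full convolution**:
`exp (Σ_{ℓ outside Q} Δ_{C|ℓ}) b = e^{Δ_C} b` for `b ∈ fieldSubalgebra (cl⁻¹ Qᶜ)` (the other pair
Laplacians kill `b`). [folklore] -/
theorem expOut_apply_of_mem [Fintype ι] (Q : Finset ι) {b : GrassmannAlgebra R Γ}
    (hb : b ∈ fieldSubalgebra R (cl ⁻¹' ((Q : Set ι)ᶜ))) :
    ((expOut (pairLap R C cl) Q : laplacianAlgebra R C cl) : Module.End R (GrassmannAlgebra R Γ)) b = gaussConv R C b := by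
  set P : Sym2 ι → Prop := fun ℓ => outsideB Q ℓ = true with hP
  have hout : ((outerSum (pairLap R C cl) Q : laplacianAlgebra R C cl) : Module.End R (GrassmannAlgebra R Γ)) =
      ∑ ℓ ∈ univ.filter P, pairLaplacian R C cl ℓ := by
    rw [outerSum, AddSubmonoidClass.coe_finsetSum]
    simp only [coe_pairLap, hP]
  have hkill : (∑ ℓ ∈ univ.filter (fun ℓ => ¬ P ℓ), pairLaplacian R C cl ℓ) b = 0 := by
    rw [LinearMap.coe_sum, Finset.sum_apply]
    refine Finset.sum_eq_zero fun ℓ hℓ => ?_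
    have hℓ' : ¬ outsideB Q ℓ = true := (Finset.mem_filter.1 hℓ).2
    rw [outsideB_eq_true_iff] at hℓ'
    push Not at hℓ'
    obtain ⟨w, hw, hwQ⟩ := hℓ'
    exact pairLaplacian_eq_zero_of_not_subset R C cl (Q := ((Q : Set ι)ᶜ)) ⟨w, hw, fun h => h (Finset.mem_coe.2 hwQ)⟩ hb
  have hcomm : Commute (∑ ℓ ∈ univ.filter P, pairLaplacian R C cl ℓ)
      (∑ ℓ ∈ univ.filter (fun ℓ => ¬ P ℓ), pairLaplacian R C cl ℓ) :=
    Commute.sum_left _ _ _ fun ℓ _ => Commute.sum_right _ _ _ fun ℓ' _ => commute_pairLaplacian R C cl ℓ ℓ'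
  have hn1 : IsNilpotent (∑ ℓ ∈ univ.filter P, pairLaplacian R C cl ℓ) :=
    Commute.isNilpotent_sum (fun ℓ _ => isNilpotent_pairLaplacian R C cl ℓ) fun ℓ ℓ' _ _ => commute_pairLaplacian R C cl ℓ ℓ'
  have hn2 : IsNilpotent (∑ ℓ ∈ univ.filter (fun ℓ => ¬ P ℓ), pairLaplacian R C cl ℓ) :=
    Commute.isNilpotent_sum (fun ℓ _ => isNilpotent_pairLaplacian R C cl ℓ) fun ℓ ℓ' _ _ => commute_pairLaplacian R C cl ℓ ℓ'
  rw [expOut, coe_exp R C cl (isNilpotent_outerSum (isNilpotent_pairLap R C cl) Q), hout, gaussConv_def,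
    ← sum_pairLaplacian R C cl, ← Finset.sum_filter_add_sum_filter_not univ P,
    IsNilpotent.exp_add_of_commute hcomm hn1 hn2, Module.End.mul_apply,
    exp_apply_eq_self_of_apply_eq_zero R hn2 hkill]

omit [DecidableEq Γ] in
/-- **The tree factor of a script lies in the algebra of the pair Laplacians of the pairs inside its
point set.** [folklore] -/
theorem coe_treeFactor_mem_lapAdjoin {v : ι} {k : ℕ} (s : Script v k) :
    ((Script.treeFactor (pairLap R C cl) s : laplacianAlgebra R C cl) : Module.End R (GrassmannAlgebra R Γ)) ∈
      lapAdjoin R C cl {ℓ | insideB (univ.image s.y) ℓ = true} := by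
  set I : Set (Sym2 ι) := {ℓ | insideB (univ.image s.y) ℓ = true} with hI
  -- the pair Laplacians of the inside pairs, as elements of the smaller algebra
  set D' : Sym2 ι → lapAdjoin R C cl I := fun ℓ =>
    if h : insideB (univ.image s.y) ℓ = true then ⟨pairLaplacian R C cl ℓ, pairLaplacian_mem_lapAdjoin R C cl h⟩ else 0
    with hD'
  have hD'nil : ∀ ℓ, IsNilpotent (D' ℓ) := by
    intro ℓ
    by_cases h : insideB (univ.image s.y) ℓ = true
    · rw [hD']; dsimp only; rw [dif_pos h]
      exact isNilpotent_of_coe R C cl (isNilpotent_pairLaplacian R C cl ℓ)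
    · rw [hD']; dsimp only; rw [dif_neg h]; exact IsNilpotent.zero
  set φ : lapAdjoin R C cl I →ₐ[R] laplacianAlgebra R C cl :=
    Subalgebra.inclusion (lapAdjoin_mono R C cl (Set.subset_univ I)) with hφ
  have hcongr : Script.treeFactor (pairLap R C cl) s = Script.treeFactor (φ.toRingHom ∘ D') s := by
    refine treeFactor_congr s fun ℓ hℓ => Subtype.ext ?_
    rw [hD']
    simp only [Function.comp_apply, AlgHom.toRingHom_eq_coe, RingHom.coe_coe, dif_pos hℓ, hφ,
      Subalgebra.inclusion_mk, coe_pairLap]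
  rw [hcongr, ← map_treeFactor φ.toRingHom D' hD'nil s]
  exact (Script.treeFactor D' s).2

omit [Fintype ι] in
/-- **The tree factor passes factors supported outside its point set**:
`treeFactor s (a b) = (treeFactor s a) b` for `b ∈ fieldSubalgebra (cl⁻¹ Q_sᶜ)`. [folklore] -/
theorem treeFactor_apply_mul_right [Fintype ι] {v : ι} {k : ℕ} (s : Script v k) (a : GrassmannAlgebra R Γ)
    {b : GrassmannAlgebra R Γ} (hb : b ∈ fieldSubalgebra R (cl ⁻¹' ((univ.image s.y : Set ι)ᶜ))) :
    ((Script.treeFactor (pairLap R C cl) s : laplacianAlgebra R C cl) : Module.End R (GrassmannAlgebra R Γ)) (a * b) =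
      ((Script.treeFactor (pairLap R C cl) s : laplacianAlgebra R C cl) : Module.End R (GrassmannAlgebra R Γ)) a * b := by
  have key : ∀ T ∈ lapAdjoin R C cl {ℓ | insideB (univ.image s.y) ℓ = true},
      ∀ a' : GrassmannAlgebra R Γ, T (a' * b) = T a' * b := by
    intro T hT
    induction hT using Algebra.adjoin_induction with
    | mem x hx =>
      obtain ⟨ℓ, hℓ, rfl⟩ := hx
      intro a'
      refine pairLaplacian_mul_eq_mul_right R C cl (Q' := ((univ.image s.y : Set ι)ᶜ)) (fun w hw hwc => hwc ?_) a' hb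
      exact_mod_cast (insideB_eq_true_iff _ ℓ).1 hℓ w hw
    | algebraMap r => intro a'; rw [Module.algebraMap_end_apply, Module.algebraMap_end_apply, smul_mul_assoc]
    | add x y _ _ hx hy => intro a'; rw [LinearMap.add_apply, LinearMap.add_apply, hx, hy, add_mul]
    | mul x y _ _ hx hy => intro a'; rw [Module.End.mul_apply, Module.End.mul_apply, hy, hx]
  exact key _ (coe_treeFactor_mem_lapAdjoin R C cl s) a

omit [Fintype ι] in
/-- **A product of pair Laplacians one of whose lines leaves `W` kills the fields of `W`.** [folklore] -/
theorem prod_pairLap_apply_eq_zero (W : Finset ι) :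
    ∀ (L : List (Sym2 ι)), (∃ ℓ ∈ L, ∃ w ∈ ℓ, w ∉ W) → ∀ {a : GrassmannAlgebra R Γ},
      a ∈ fieldSubalgebra R (cl ⁻¹' (W : Set ι)) →
        ((L.map (pairLap R C cl)).prod : Module.End R (GrassmannAlgebra R Γ)) a = 0
  | [], h, _, _ => by simp at h
  | ℓ :: L, h, a, ha => by
    rw [List.map_cons, List.prod_cons, MulMemClass.coe_mul, Module.End.mul_apply, coe_pairLap]
    by_cases hℓ : ∃ w ∈ ℓ, w ∉ W
    · refine pairLaplacian_eq_zero_of_not_subset R C cl (Q := (W : Set ι)) ?_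
        (apply_mem_fieldSubalgebra_of_mem_lapAdjoin R C cl ((L.map (pairLap R C cl)).prod).2 ha)
      obtain ⟨w, hw, hwW⟩ := hℓ
      exact ⟨w, hw, by exact_mod_cast hwW⟩
    · have h' : ∃ ℓ' ∈ L, ∃ w ∈ ℓ', w ∉ W := by
        obtain ⟨ℓ', hℓ', hw⟩ := h
        rcases List.mem_cons.1 hℓ' with rfl | hmem
        · exact absurd hw hℓ
        · exact ⟨ℓ', hmem, hw⟩
      rw [prod_pairLap_apply_eq_zero W L h' ha, map_zero]

end Support

/-! ### The even part: convolution moments and their tree expansion -/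

section Even

variable (R : Type*) [CommRing R] [Algebra ℚ R] {Γ : Type*} [Fintype Γ] (C : Matrix Γ Γ R)

/-- **The Gaussian convolution on the even part**: `e^{Δ_C}` restricted to the commutative ring
`⋀^{even}` (it preserves parity). [folklore] -/
def evenGaussConv : evenPart R Γ →ₗ[R] evenPart R Γ where
  toFun x := ⟨gaussConv R C x, gaussConv_mem_evenOdd R C x.2⟩
  map_add' x y := Subtype.ext (by simp)
  map_smul' r x := Subtype.ext (by simp)

/-- Unfolding `evenGaussConv`. [folklore] -/
@[simp] theorem coe_evenGaussConv (x : evenPart R Γ) : (evenGaussConv R C x : GrassmannAlgebra R Γ) = gaussConv R C x :=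
  rfl

variable {ι : Type*} (M : ι → evenPart R Γ)

/-- The **convolution moments** of a family of even elements: `Q ↦ e^{Δ_C} (∏_{v∈Q} M v) ∈ ⋀^{even}`
(the simple expectations `𝓔(∏ M v)` of the Gaussian integration of covariance `C`, the uncontracted
fields kept). [folklore] -/
def convMoment (Q : Finset ι) : evenPart R Γ := evenGaussConv R C (∏ v ∈ Q, M v)

/-- `𝓔(∏_∅) = 1`. [folklore] -/
theorem convMoment_empty : convMoment R C M ∅ = 1 :=
  Subtype.ext (by rw [convMoment, prod_empty, coe_evenGaussConv, OneMemClass.coe_one, gaussConv_one])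

variable [DecidableEq ι] (cl : Γ → ι)

/-- **The action of the algebra of the pair Laplacians on the even part**, as an algebra
homomorphism into `End(⋀^{even})`. [folklore] -/
def onEven : laplacianAlgebra R C cl →ₐ[R] Module.End R (evenPart R Γ) where
  toFun T :=
    { toFun := fun x => ⟨(T : Module.End R (GrassmannAlgebra R Γ)) x,
        apply_mem_evenOdd_of_mem_lapAdjoin R C cl T.2 x.2⟩
      map_add' := fun x y => Subtype.ext (by simp)
      map_smul' := fun r x => Subtype.ext (by simp) }
  map_one' := LinearMap.ext fun x => Subtype.ext rfl
  map_mul' T T' := LinearMap.ext fun x => Subtype.ext rfl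
  map_zero' := LinearMap.ext fun x => Subtype.ext rfl
  map_add' T T' := LinearMap.ext fun x => Subtype.ext rfl
  commutes' r := LinearMap.ext fun x => Subtype.ext (by
    simp [Module.algebraMap_end_apply, Subalgebra.coe_algebraMap])

/-- Unfolding `onEven`. [folklore] -/
@[simp] theorem coe_onEven_apply (T : laplacianAlgebra R C cl) (x : evenPart R Γ) :
    (onEven R C cl T x : GrassmannAlgebra R Γ) = (T : Module.End R (GrassmannAlgebra R Γ)) x := rfl

/-- `onEven (exp Σ_ℓ Δ_{C|ℓ}) = e^{Δ_C}|_{⋀^{even}}`. [folklore] -/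
theorem onEven_exp_sum_pairLap [Fintype ι] :
    onEven R C cl (IsNilpotent.exp (∑ ℓ : Sym2 ι, pairLap R C cl ℓ)) = evenGaussConv R C :=
  LinearMap.ext fun x => Subtype.ext (by rw [coe_onEven_apply, coe_exp_sum_pairLap, coe_evenGaussConv])

variable [Fintype ι]

/-- **The tree operator** `K_v(Q) = Σ_{valid scripts s rooted at v with point set Q} treeFactor s`
(Mastropietro 2008, (2.93)/(2.101): `K(X_r)`). [folklore] -/
def treeOp (v : ι) (Q : Finset ι) : laplacianAlgebra R C cl :=
  ∑ k ∈ Finset.range (Fintype.card ι), ∑ s : Script v k,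
    if s.Valid ∧ univ.image s.y = Q then Script.treeFactor (pairLap R C cl) s else 0

variable [DecidableEq Γ] {M}

/-- **One script, applied to a product of cluster elements.**  For a valid script `s` with point
set `Q` and even `M v` supported on cluster `v`:
`treeFactor s (expOut Q (∏_{v∈W} M v)) = [Q ⊆ W] · treeFactor s (∏_{v∈Q} M v) · e^{Δ_C}(∏_{v∈W∖Q} M v)`.
[folklore] -/
theorem treeFactor_expOut_apply_prod (hM : ∀ v, (M v : GrassmannAlgebra R Γ) ∈ fieldSubalgebra R (cl ⁻¹' {v}))
    (W : Finset ι) {v : ι} (hv : v ∈ W) {k : ℕ} (s : Script v k) :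
    ((Script.treeFactor (pairLap R C cl) s : laplacianAlgebra R C cl) : Module.End R (GrassmannAlgebra R Γ))
        (((expOut (pairLap R C cl) (univ.image s.y) : laplacianAlgebra R C cl) : Module.End R (GrassmannAlgebra R Γ)) ↑(∏ w ∈ W, M w)) =
      if univ.image s.y ⊆ W then
        ↑(onEven R C cl (Script.treeFactor (pairLap R C cl) s) (∏ w ∈ univ.image s.y, M w) * convMoment R C M (W \ univ.image s.y))
      else 0 := by
  set Q := univ.image s.y with hQ
  split_ifs with hQW
  · -- split the product, pass `∏_Q` through `expOut`, integrate `∏_{W∖Q}` fully, pass it through the tree factor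
    have hprod : (∏ w ∈ W, M w) = (∏ w ∈ Q, M w) * ∏ w ∈ W \ Q, M w := by
      rw [mul_comm, Finset.prod_sdiff hQW]
    have hxQ : ((∏ w ∈ Q, M w : evenPart R Γ) : GrassmannAlgebra R Γ) ∈ fieldSubalgebra R (cl ⁻¹' (Q : Set ι)) :=
      coe_prod_mem_fieldSubalgebra_preimage R cl hM Q
    have hy : ((∏ w ∈ W \ Q, M w : evenPart R Γ) : GrassmannAlgebra R Γ) ∈ fieldSubalgebra R (cl ⁻¹' ((Q : Set ι)ᶜ)) := by
      refine fieldSubalgebra_mono R (Set.preimage_mono fun w hw => ?_) (coe_prod_mem_fieldSubalgebra_preimage R cl hM (W \ Q))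
      exact (Finset.mem_sdiff.1 (Finset.mem_coe.1 hw)).2
    rw [hprod, MulMemClass.coe_mul, expOut_apply_mul_left R C cl Q hxQ (∏ w ∈ Q, M w).2,
      expOut_apply_of_mem R C cl Q hy,
      treeFactor_apply_mul_right R C cl s _ (gaussConv_mem_fieldSubalgebra R C hy),
      MulMemClass.coe_mul, coe_onEven_apply, convMoment, coe_evenGaussConv]
  · -- a point of the script outside `W`: one of its lines leaves `W`
    obtain ⟨z, hzQ, hzW⟩ := Finset.not_subset.1 hQW
    obtain ⟨m, -, rfl⟩ := Finset.mem_image.1 hzQ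
    have hm : m ≠ 0 := fun h => hzW (by rw [h, Script.y_zero]; exact hv)
    obtain ⟨ℓ, hℓ, hzℓ⟩ := Script.exists_mem_lines s m hm
    have hW : ((∏ w ∈ W, M w : evenPart R Γ) : GrassmannAlgebra R Γ) ∈ fieldSubalgebra R (cl ⁻¹' (W : Set ι)) :=
      coe_prod_mem_fieldSubalgebra_preimage R cl hM W
    rw [Script.treeFactor_eq_prod_mul, MulMemClass.coe_mul, Module.End.mul_apply]
    exact prod_pairLap_apply_eq_zero R C cl W s.lines ⟨ℓ, hℓ, s.y m, hzℓ, fun h => hzW h⟩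
      (apply_mem_fieldSubalgebra_of_mem_lapAdjoin R C cl (Subtype.mem _)
        (apply_mem_fieldSubalgebra_of_mem_lapAdjoin R C cl (Subtype.mem _) hW))

/-- **The peeling recursion for the convolution moments** (Mastropietro 2008, (2.91)/(2.99)): for
even cluster-supported `M v` and every `v ∈ W`,
`e^{Δ_C}(∏_{W} M) = Σ_{v ∈ Q ⊆ W} K_v(Q)(∏_{Q} M) · e^{Δ_C}(∏_{W∖Q} M)`. [cite: Mastropietro2008, §2.8 (2.91)-(2.99)] -/
theorem convMoment_eq_sum_treeOp (hM : ∀ v, (M v : GrassmannAlgebra R Γ) ∈ fieldSubalgebra R (cl ⁻¹' {v}))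
    (W : Finset ι) {v : ι} (hv : v ∈ W) :
    convMoment R C M W = ∑ Q ∈ W.powerset.filter (fun Q => v ∈ Q),
      onEven R C cl (treeOp R C cl v Q) (∏ w ∈ Q, M w) * convMoment R C M (W \ Q) := by
  set T := W.powerset.filter (fun Q => v ∈ Q) with hT
  have hmem : ∀ {k : ℕ} (s : Script v k), univ.image s.y ∈ T ↔ univ.image s.y ⊆ W := by
    intro k s
    rw [hT, Finset.mem_filter, Finset.mem_powerset, and_iff_left_iff_imp]
    exact fun _ => Finset.mem_image.2 ⟨0, Finset.mem_univ _, s.y_zero⟩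
  -- the expansion of `e^{Δ_C}` applied to `∏_W M`, script by script
  have h1 : ∀ (k : ℕ) (s : Script v k),
      (if s.Valid then ((Script.treeFactor (pairLap R C cl) s : laplacianAlgebra R C cl) : Module.End R (GrassmannAlgebra R Γ))
        (((expOut (pairLap R C cl) (univ.image s.y) : laplacianAlgebra R C cl) : Module.End R (GrassmannAlgebra R Γ)) ↑(∏ w ∈ W, M w)) else 0) =
      ((∑ Q ∈ T, if s.Valid ∧ univ.image s.y = Q then
        onEven R C cl (Script.treeFactor (pairLap R C cl) s) (∏ w ∈ Q, M w) * convMoment R C M (W \ Q) else 0 :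
          evenPart R Γ) : GrassmannAlgebra R Γ) := by
    intro k s
    by_cases hs : s.Valid
    · simp only [hs, if_true, true_and]
      rw [treeFactor_expOut_apply_prod R C cl hM W hv s, Finset.sum_ite_eq, if_congr (hmem s) rfl rfl]
      split_ifs <;> simp
    · simp only [hs, if_false, false_and]
      rw [Finset.sum_const_zero, ZeroMemClass.coe_zero]
  refine Subtype.ext ?_
  rw [convMoment, coe_evenGaussConv, gaussConv_apply_eq_sum R C cl v]
  calc ∑ k ∈ Finset.range (Fintype.card ι), ∑ s : Script v k,
        (if s.Valid then ((Script.treeFactor (pairLap R C cl) s : laplacianAlgebra R C cl) : Module.End R (GrassmannAlgebra R Γ))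
          (((expOut (pairLap R C cl) (univ.image s.y) : laplacianAlgebra R C cl) : Module.End R (GrassmannAlgebra R Γ)) ↑(∏ w ∈ W, M w)) else 0)
      = ((∑ k ∈ Finset.range (Fintype.card ι), ∑ s : Script v k, ∑ Q ∈ T,
          (if s.Valid ∧ univ.image s.y = Q then
            onEven R C cl (Script.treeFactor (pairLap R C cl) s) (∏ w ∈ Q, M w) * convMoment R C M (W \ Q) else 0) :
              evenPart R Γ) : GrassmannAlgebra R Γ) := by
        rw [AddSubmonoidClass.coe_finsetSum]
        refine Finset.sum_congr rfl fun k _ => ?_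
        rw [AddSubmonoidClass.coe_finsetSum]
        exact Finset.sum_congr rfl fun s _ => h1 k s
    _ = ((∑ Q ∈ T, ∑ k ∈ Finset.range (Fintype.card ι), ∑ s : Script v k,
          (if s.Valid ∧ univ.image s.y = Q then
            onEven R C cl (Script.treeFactor (pairLap R C cl) s) (∏ w ∈ Q, M w) * convMoment R C M (W \ Q) else 0) :
              evenPart R Γ) : GrassmannAlgebra R Γ) := by
        rw [Finset.sum_comm]
        congr 1
        exact Finset.sum_congr rfl fun k _ => Finset.sum_comm
    _ = ((∑ Q ∈ T, onEven R C cl (treeOp R C cl v Q) (∏ w ∈ Q, M w) * convMoment R C M (W \ Q) : evenPart R Γ) :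
          GrassmannAlgebra R Γ) := by
        congr 1
        refine Finset.sum_congr rfl fun Q _ => ?_
        rw [treeOp, map_sum, LinearMap.sum_apply, Finset.sum_mul]
        refine Finset.sum_congr rfl fun k _ => ?_
        rw [map_sum, LinearMap.sum_apply, Finset.sum_mul]
        refine Finset.sum_congr rfl fun s _ => ?_
        split_ifs
        · rfl
        · rw [map_zero, LinearMap.zero_apply, zero_mul]

/-- **The tree expansion of the truncated expectations of the Gaussian convolution**
(Battle–Brydges–Federbush / Gawedzki–Kupiainen–Lesniewski, operator form; Benfatto–Giuliani–Mastropietro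
2006, (2.66); Mastropietro 2008, (2.101)/(2.118)): for even elements `M v` supported on the fields of
cluster `v`, the truncated expectation `𝓔ᵀ_C(M v : v ∈ W)` — the Ursell function of the convolution
moments `Q ↦ e^{Δ_C}(∏_{v∈Q} M v)`, an element of `⋀^{even}` in the uncontracted fields — equals, for every
root `v ∈ W`, the tree operator applied to the product:
`𝓔ᵀ_C(M v : v ∈ W) = Σ_{valid s rooted at v spanning W} ∫ w_s(t) (∏_{ℓ∈lines s} Δ_{C|ℓ}) e^{Δ_{σ_s(t)∘C|W}} dt (∏_{v∈W} M v)`.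
[cite: BenfattoGiulianiMastropietro2006, §2.3 (2.66)] -/
theorem ursellOf_convMoment_eq_treeOp (hM : ∀ v, (M v : GrassmannAlgebra R Γ) ∈ fieldSubalgebra R (cl ⁻¹' {v}))
    (W : Finset ι) {v : ι} (hv : v ∈ W) :
    ursellOf (convMoment R C M) W = onEven R C cl (treeOp R C cl v W) (∏ w ∈ W, M w) :=
  (FermionicTree.eq_ursellOf_of_block_recursion (convMoment R C M) (convMoment_empty R C M)
    (fun v Q => onEven R C cl (treeOp R C cl v Q) (∏ w ∈ Q, M w))
    (fun W _ hv => (convMoment_eq_sum_treeOp R C cl hM W hv).symm) W v hv).symm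

end Even

end Literature.MathematicalPhysics.QuantumLattice
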